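/-
Copyright (c) 2026 the pub-hodgecm-mathlib formalisation cell (harness21).  Prover seat hodgecm-mathlib-B-p04 (g61), req618 STAGE 1a «FOUR-FRAME» squad (director s1808;
LEAD directive v1.1 d3f1616d0136e728), dealer LH4-plan (g10) WORD #4 deal g10-#8 «(ii-0) TREE FROM TRANSITIVITY».  2026-09-03.
-/
import Summits.HodgeConjecture.HodgeConjecture.Theorems.F0P3cDyRamFourFrameLawDefs    -- dealer №1 «LAW-DEFS LEAF» (LH4-plan (g10) 4d226e08ddae099b, filed by LH4-p03): `WildTransitivityAt`, `WildTreeAt`, `WildTransitivity`, `WildTree`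
import Literature.NumberTheory.Automorphic.UnitaryLatticeTreeFramesOfInvolution        -- ★ `isTree_latticeGraph_three_of_transitive` :266 (B-p14 (g37), datum-free edition R5d)
import HarnessLib

/-!
# (D-RAM) «FOUR-FRAME» road, unit (ii-0): the wild lattice graph at `Φ₃` is a TREE as soon as `U(σ, Φ₃)` is transitive on the two vertex types —
# `wildTreeAt_of_wildTransitivityAt : WildTransitivityAt σ ϖ d t → WildTreeAt σ ϖ d t`

Cell `pub/hodgecm-mathlib` (D-0151), crux H413 = `stmt-HodgeConjecture-24833`, organ (D-RAM) `stub_DyRamCore` (leaf `Cruxes/H413/Lines/F0_P3c_DyadicPaydown.lean` ED. 4 :147),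
«FOUR-FRAME» road (socket certificate v1.1 `dyRamCore_of_fourFrame`; LAWSOCKET v1.2 435f8f380eccb322); deal g10-#8 of the dealer LH4-plan (g10), lane
`--kind proof --supports stmt-HodgeConjecture-24833`.  THEOREMS ONLY (no definition, no instance, no notation, no `sorry`).

WHAT.  The summit-side law-defs module `F0P3cDyRamFourFrameLawDefs` (dealer №1) types the unit-(ii-0) target `WildTransitivityAt σ ϖ d t` — behind the wild datum
`IsRamifiedQuadraticDatum σ ϖ d t` and the dyadic fence `|2| < 1`, the two transitivity binders `htr₀` (every self-dual vertex lattice of `(K³, Φ₃)` is `u · 𝒪³`) and `htr₂`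
(every type-2 vertex lattice is `u · latt diag(1, 1, ϖ)`) — and the consumer-facing `WildTreeAt σ ϖ d t` (behind the same datum and fence, `(latticeGraph σ ϖ Φ₃).IsTree`).
This file proves the implication **`WildTransitivityAt σ ϖ d t → WildTreeAt σ ϖ d t`** (and the closed `WildTransitivity → WildTree`) by the ★ datum-free theorem
`isTree_latticeGraph_three_of_transitive` (B-p14 (g37), `UnitaryLatticeTreeFramesOfInvolution` :266: for ANY isometric involution `σ` and uniformiser `ϖ`, transitivity on the
two vertex types ⇒ the lattice graph of `(K³, Φ₃)` is a tree — Cartan decomposition for any involution ∘ ★ R5c `isTree_latticeGraph_three_of_frames`).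

THE ONE REAL STEP (dealer's word).  ★ :266 is stated over `[Valued K ℤᵐ⁰] [ValuativeRel K] [(Valued.v : Valuation K ℤᵐ⁰).Compatible]` (its Cartan∕Iwasawa inputs live in
the `ValuativeRel` currency of ★ `glInt`), while the law-defs Props bind `[Valued K ℤᵐ⁰] [CompleteSpace K] [Fintype 𝓀[K]]` only.  Inside the proof we INSTALL the valuative
relation OF `Valued.v` — Mathlib `ValuativeRel.ofValuation (Valued.v : Valuation K ℤᵐ⁰)` with `Valuation.Compatible.ofValuation` — exactly as ★ `HyperspecialUnitarySatakeWeylInvariance`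
∕ ★ `SymplecticSatakeSiegelDescent` do; the conclusion `(latticeGraph σ ϖ Φ₃).IsTree` mentions no valuative relation, so nothing leaks.  The datum supplies ★ :266's three
hypotheses `hσ` (involution), `hvσ` (isometry), `hϖ` (uniformiser); `d`, `t`, the fence, completeness and the residue field are NOT used by this step (they are used by the
transitivity theorems that feed `WildTransitivityAt`: ★ `exists_unitary_mapGL_stdLattice_eq_of_isSelfDualLattice_of_ramified` (LH4-p01 (g17), p854568) for `htr₀`; LH4-p02's
`htr₂` files).

* `isTree_latticeGraph_three_of_transitive_valued` — ★ :266 restated over `[Valued K ℤᵐ⁰]` alone (the instance bridge, once).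
* **`wildTreeAt_of_wildTransitivityAt`**, **`wildTree_of_wildTransitivity`** — THE DEAL'S HEADS, by name over the dealer's Props.

HONEST LABEL: HC_CM is proved only modulo the 7 printed citations (2 remaining named inputs: hLiu418 = stmt-HodgeConjecture-24832, h413 = stmt-HodgeConjecture-24833) until rung 0
closes; this file is a five-line composition over ★ and moves no verdict and no registry (count-neutral `--supports` helper).
-/

noncomputable section

open scoped Valued WithZero Matrix MatrixGroups

namespace Summit.HodgeConjecture.HodgeConjecture.Cruxes.H413.F0P3cDyRamWildTreeOfTransitivity

open Literature.NumberTheory.Automorphic Literature.NumberTheory.Automorphic.HermitianLattice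
  Literature.NumberTheory.Automorphic.UnitaryLatticeTree Literature.NumberTheory.Automorphic.UnitaryThreeFourFrame
  Summit.HodgeConjecture.HodgeConjecture.Cruxes.H413.F0P3cDyRamFourFrameLawDefs

/-- **★ :266 over `[Valued K ℤᵐ⁰]` alone**: for an isometric involution `σ` and a uniformiser `ϖ`, transitivity of `U(σ, Φ₃)` on the self-dual and on the type-2 vertex
lattices implies that the lattice graph of `(K³, Φ₃)` is a TREE — ★ `isTree_latticeGraph_three_of_transitive` with the valuative relation of `Valued.v` installed inside the proof
(Mathlib `ValuativeRel.ofValuation`, `Valuation.Compatible.ofValuation`). [cite: BruhatTits1972, §10] [cite: Tits1979, §2.7 (p. 48); §2.10 (p. 49)] [cite: Serre1980Trees, II.1.1] -/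
theorem isTree_latticeGraph_three_of_transitive_valued {K : Type*} [Field K] [Valued K ℤᵐ⁰] {σ : K →+* K} {ϖ : K}
    (hσ : ∀ x, σ (σ x) = x) (hvσ : ∀ a, Valued.v (σ a) = Valued.v a) (hϖ : Valued.v ϖ = WithZero.exp (-1 : ℤ))
    (htr₀ : ∀ L : Submodule 𝒪[K] (Fin 3 → K), IsSelfDualLattice σ ϖ ((StdForm.antidiagonal 3).over K) L →
      ∃ u : unitaryGroupOfForm σ ((StdForm.antidiagonal 3).over K), L = mapGL (u : GL (Fin 3) K) (stdLattice K 3))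
    (htr₂ : ∀ M : Submodule 𝒪[K] (Fin 3 → K), IsVertexLattice σ ϖ ((StdForm.antidiagonal 3).over K) 2 M →
      ∃ u : unitaryGroupOfForm σ ((StdForm.antidiagonal 3).over K), M = mapGL (u : GL (Fin 3) K) (latt (Matrix.diagonal ![(1 : K), 1, ϖ]))) :
    (latticeGraph σ ϖ ((StdForm.antidiagonal 3).over K)).IsTree := by
  letI : ValuativeRel K := ValuativeRel.ofValuation (Valued.v : Valuation K ℤᵐ⁰)
  haveI : (Valued.v : Valuation K ℤᵐ⁰).Compatible := Valuation.Compatible.ofValuation _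
  exact isTree_latticeGraph_three_of_transitive hσ hvσ hϖ htr₀ htr₂

/-- **DEAL g10-#8 — THE WILD TREE FROM WILD TRANSITIVITY AT ONE DATUM: `WildTransitivityAt σ ϖ d t → WildTreeAt σ ϖ d t`.**  Unfold both Props behind the common datum and
fence; the datum's conjuncts give `hσ`, `hvσ`, `hϖ`; apply `isTree_latticeGraph_three_of_transitive_valued` to the two transitivity binders.
[cite: BruhatTits1972, §10] [cite: Tits1979, §2.7 (p. 48)] [cite: Serre1980Trees, II.1.1] -/
theorem wildTreeAt_of_wildTransitivityAt {K : Type} [Field K] [Valued K ℤᵐ⁰] [CompleteSpace K] [Fintype 𝓀[K]] (σ : K →+* K) (ϖ : K) (d t : ℕ)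
    (h : WildTransitivityAt σ ϖ d t) : WildTreeAt σ ϖ d t := by
  intro hD h2
  obtain ⟨htr₀, htr₂⟩ := h hD h2
  obtain ⟨hσ, hvσ, hϖ, -, -, -, -⟩ := hD
  exact isTree_latticeGraph_three_of_transitive_valued hσ hvσ hϖ htr₀ htr₂

/-- **The closed form: `WildTransitivity → WildTree`** (every complete datum with finite residue field). [cite: BruhatTits1972, §10] [cite: Serre1980Trees, II.1.1] -/
theorem wildTree_of_wildTransitivity (h : WildTransitivity) : WildTree :=
  fun σ ϖ d t => wildTreeAt_of_wildTransitivityAt σ ϖ d t (h σ ϖ d t)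

end Summit.HodgeConjecture.HodgeConjecture.Cruxes.H413.F0P3cDyRamWildTreeOfTransitivity

end
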